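import Summits.BirchSwinnertonDyer.BirchSwinnertonDyer.Theorems.ResidualThetaTransportAtTwoThetaLayerLambdaCongruenceAtTwoDualChain
import Summits.BirchSwinnertonDyer.BirchSwinnertonDyer.Theorems.ResidualThetaTransportAtTwoThetaLayerLambdaCongruenceAtTwoDualChainAcyclic
import HarnessLib

/-!
# Crux `ThetaLayerLambdaCongruenceAtTwo` (stmt-BirchSwinnertonDyer-20688, route ResidualThetaTransportAtTwo), line
# `birth` v13 — SD floor, brick S4 (part 3): the signed crossing vector of a dual chain of `γ ∈ Γ₀(N)` is INDEPENDENT OF THE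
# CHAIN, ADDITIVE in `γ`, and VANISHES on elliptic elements (width seat bsd-wall-rtt-p3-w2 g8;
# `--supports stmt-BirchSwinnertonDyer-20688 --as helper`; closes nothing)

HONEST FRAMING. Elementary THEOREMS on lists of matrices and the coset space `SL₂(ℤ)/Γ₀(N)` (currency of `…DualChain`); no definition;
nothing about any curve or form is asserted; BSD is not proved by any of this.

WHAT. `vec(D) := Σ_{h∈D} (e_{h⁻¹Γ₀(N)} − e_{(hS)⁻¹Γ₀(N)}) ∈ ℤ^X` (inline), dual chains as in `…DualChain` (telescoping over triangle functions).
* §1 `dualChainVec_eq_zero_of_closed`: a CLOSED dual chain (telescoping sums `0`) has `vec = 0` on `SL₂(ℤ)/Γ₀(N)` for every `N` — from the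
  tree property `…DualChainAcyclic.dualChain_closed_netCrossing_eq_zero` (net crossing `0` with every single edge), summed over the finitely
  many edges of the walk in a given `Γ₀(N)`-class (canonical sign representatives `canon`).
* §2 `dualChainVec_eq_of_dualChain` (two dual chains of the same `k` have the same vector), `dualChainVec_map_mul_left` (`vec(γ·D) = vec(D)`,
  `γ ∈ Γ₀(N)`), `dualChainVec_mul` (for dual chains `D₁, D₂, D₁₂` of `γ₁, γ₂, γ₁γ₂ ∈ Γ₀(N)`: `vec D₁₂ = vec D₁ + vec D₂`).
* §3 `dualChainVec_eq_zero_of_conj_S` / `_of_conj_tau`: `vec D = 0` for a dual chain `D` of an ELLIPTIC `γ` (`γk = kS` or `γk = kτ`): the walk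
  to `k`, one (folded, `S`-fixed) edge or nothing, and the walk back.
So `γ ↦ vec(D_γ)` is a well-defined homomorphism `Γ₀(N) → {integral Manin systems}` killing the elliptic elements — the bridge `θ` of
`Cruxes/…/Lines/birth-sd2-architecture.md` up to the parabolic elements (next file: they go to boundary systems) and Hecke.

References: J.-P. Serre, Trees, §I.4; [Manin1972] §1.5–1.7; [CremonaAlgorithms1997] §2.2.
-/

set_option autoImplicit false

noncomputable section

-- justification: the `Summit.BirchSwinnertonDyer.BirchSwinnertonDyer.…` path repeats a component (route-file convention)
set_option linter.dupNamespace false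

open scoped Classical MatrixGroups

open CongruenceSubgroup Matrix.SpecialLinearGroup ModularGroup
open Literature.NumberTheory.EllipticCurves.ModularForms

namespace Summit.BirchSwinnertonDyer.BirchSwinnertonDyer.Theorems.ThetaLayerLambdaCongruenceAtTwo

/-! ## §1. Closed dual chains have zero crossing vector on every `SL₂(ℤ)/Γ₀(N)` -/

section Closed

variable {N : ℕ}

/-- A list sum of finset sums is the finset sum of the list sums. [folklore] -/
theorem list_sum_map_finset_sum {ι κ : Type} (L : List ι) (s : Finset κ) (f : ι → κ → ℤ) :
    (L.map fun i ↦ ∑ k ∈ s, f i k).sum = ∑ k ∈ s, (L.map fun i ↦ f i k).sum := by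
  induction L with
  | nil => simp
  | cons a L ih => rw [List.map_cons, List.sum_cons, ih, ← Finset.sum_add_distrib]; simp

/-- Canonical sign: exactly one of `u, −u` has `u₁₀ > 0 ∨ (u₁₀ = 0 ∧ u₁₁ > 0)`; `canon u := ` that one. Here: `canon(−u) = canon(u)`. [folklore] -/
theorem canon_neg (u : SL(2, ℤ)) :
    (if (0 < (-u) 1 0 ∨ ((-u) 1 0 = 0 ∧ 0 < (-u) 1 1)) then -u else -(-u)) =
      (if (0 < u 1 0 ∨ (u 1 0 = 0 ∧ 0 < u 1 1)) then u else -u) := by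
  have e10 : (-u) 1 0 = -u 1 0 := by simp
  have e11 : (-u) 1 1 = -u 1 1 := by simp
  rw [e10, e11, neg_neg]
  have hne : ¬ (u 1 0 = 0 ∧ u 1 1 = 0) := by
    rintro ⟨h0, h1⟩
    have hdet := Matrix.det_fin_two u.1
    rw [u.2, show u.1 1 0 = u 1 0 from rfl, show u.1 1 1 = u 1 1 from rfl, h0, h1] at hdet
    simp at hdet
  by_cases hp : 0 < u 1 0 ∨ (u 1 0 = 0 ∧ 0 < u 1 1)
  · rw [if_pos hp, if_neg]
    rintro (h | ⟨h0, h1⟩)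
    · rcases hp with hp | ⟨hp0, _⟩ <;> omega
    · rcases hp with hp | ⟨_, hp1⟩ <;> omega
  · rw [if_neg hp, if_pos]
    by_cases h0 : u 1 0 = 0
    · right
      refine ⟨by omega, ?_⟩
      have h1 : u 1 1 ≠ 0 := fun h1 ↦ hne ⟨h0, h1⟩
      have : ¬ 0 < u 1 1 := fun h ↦ hp (Or.inr ⟨h0, h⟩)
      omega
    · left
      have : ¬ 0 < u 1 0 := fun h ↦ hp (Or.inl h)
      omega

/-- `canon u = u` or `canon u = −u`. [folklore] -/
theorem canon_eq_or (u : SL(2, ℤ)) :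
    (if (0 < u 1 0 ∨ (u 1 0 = 0 ∧ 0 < u 1 1)) then u else -u) = u ∨
      (if (0 < u 1 0 ∨ (u 1 0 = 0 ∧ 0 < u 1 1)) then u else -u) = -u := by
  by_cases hp : 0 < u 1 0 ∨ (u 1 0 = 0 ∧ 0 < u 1 1)
  · exact Or.inl (if_pos hp)
  · exact Or.inr (if_neg hp)

/-- `h = ±r` iff `canon h = canon r`. [folklore] -/
theorem eq_or_eq_neg_iff_canon_eq (h r : SL(2, ℤ)) :
    (h = r ∨ h = -r) ↔ (if (0 < h 1 0 ∨ (h 1 0 = 0 ∧ 0 < h 1 1)) then h else -h) =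
      (if (0 < r 1 0 ∨ (r 1 0 = 0 ∧ 0 < r 1 1)) then r else -r) := by
  constructor
  · rintro (rfl | rfl)
    · rfl
    · exact canon_neg r
  · intro e
    rcases canon_eq_or h with hh | hh <;> rcases canon_eq_or r with hr | hr
    · exact Or.inl (hh.symm.trans (e.trans hr))
    · exact Or.inr (hh.symm.trans (e.trans hr))
    · right
      have h1 : -h = r := hh.symm.trans (e.trans hr)
      rw [← h1, neg_neg]
    · exact Or.inl (neg_injective (hh.symm.trans (e.trans hr)))

/-- `canon (canon u) = canon u`. [folklore] -/
theorem canon_canon (u : SL(2, ℤ)) :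
    (if (0 < (if (0 < u 1 0 ∨ (u 1 0 = 0 ∧ 0 < u 1 1)) then u else -u) 1 0 ∨
        ((if (0 < u 1 0 ∨ (u 1 0 = 0 ∧ 0 < u 1 1)) then u else -u) 1 0 = 0 ∧
          0 < (if (0 < u 1 0 ∨ (u 1 0 = 0 ∧ 0 < u 1 1)) then u else -u) 1 1))
      then (if (0 < u 1 0 ∨ (u 1 0 = 0 ∧ 0 < u 1 1)) then u else -u)
      else -(if (0 < u 1 0 ∨ (u 1 0 = 0 ∧ 0 < u 1 1)) then u else -u)) =
      (if (0 < u 1 0 ∨ (u 1 0 = 0 ∧ 0 < u 1 1)) then u else -u) := by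
  rcases canon_eq_or u with h | h
  · rw [h]; exact h
  · rw [h, canon_neg u]; exact h

/-- The coset of `canon u` is the coset of `u` (`−1 ∈ Γ₀(N)`). [folklore] -/
theorem coe_canon_inv (u : SL(2, ℤ)) :
    (((if (0 < u 1 0 ∨ (u 1 0 = 0 ∧ 0 < u 1 1)) then u else -u)⁻¹ : SL(2, ℤ)) : Gamma0Coset N) =
      ((u⁻¹ : SL(2, ℤ)) : Gamma0Coset N) := by
  rcases canon_eq_or u with h | h
  · rw [h]
  · rw [h, QuotientGroup.eq, inv_inv, neg_mul, mul_inv_cancel]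
    simp [Gamma0_mem]

/-- **Closed dual chains have zero signed crossing vector on `SL₂(ℤ)/Γ₀(N)`** (every `N`): the tree property
`dualChain_closed_netCrossing_eq_zero` (net crossing `0` with each single Farey edge), summed over the finitely many edges of the walk that
lie in a given `Γ₀(N)`-class. [cite: Manin1972, §1.5] -/
theorem dualChainVec_eq_zero_of_closed (W : List SL(2, ℤ))
    (hW : ∀ {A : Type} [AddCommGroup A] (G : SL(2, ℤ) → A),
      (∀ x, G (x * (S * T⁻¹)) = G x) → (∀ x, G (-x) = G x) → (W.map fun h ↦ G h - G (h * S)).sum = 0)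
    (q : Gamma0Coset N) :
    (W.map fun h ↦ (Pi.single ((h⁻¹ : SL(2, ℤ)) : Gamma0Coset N) (1 : ℤ) -
      Pi.single (((h * S)⁻¹ : SL(2, ℤ)) : Gamma0Coset N) 1 : Gamma0Coset N → ℤ)).sum q = 0 := by
  rw [dualChainVec_apply]
  -- canonical representatives of the `±`-classes met by the walk, with coset `q`
  obtain ⟨canon, hcanon⟩ : ∃ canon : SL(2, ℤ) → SL(2, ℤ),
      ∀ u, canon u = if (0 < u 1 0 ∨ (u 1 0 = 0 ∧ 0 < u 1 1)) then u else -u := ⟨_, fun _ ↦ rfl⟩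
  have canon_inv : ∀ u, (((canon u)⁻¹ : SL(2, ℤ)) : Gamma0Coset N) = ((u⁻¹ : SL(2, ℤ)) : Gamma0Coset N) := fun u ↦ by
    rw [hcanon]; exact coe_canon_inv u
  have canon_idem : ∀ u, canon (canon u) = canon u := fun u ↦ by
    rw [hcanon (canon u), hcanon u]; exact canon_canon u
  have canon_iff : ∀ h r, canon r = r → ((canon h = r) ↔ (h = r ∨ h = -r)) := fun h r hr ↦ by
    rw [eq_or_eq_neg_iff_canon_eq, ← hcanon, ← hcanon, hr]
  let R : Finset SL(2, ℤ) := ((W ++ W.map fun h ↦ h * S).map canon).toFinset.filter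
    fun r ↦ ((r⁻¹ : SL(2, ℤ)) : Gamma0Coset N) = q
  -- indicator of the coset as a sum over representatives
  have hind : ∀ v ∈ W ++ W.map (fun h ↦ h * S),
      (if ((v⁻¹ : SL(2, ℤ)) : Gamma0Coset N) = q then (1 : ℤ) else 0) = ∑ r ∈ R, (if canon v = r then (1 : ℤ) else 0) := by
    intro v hv
    rw [Finset.sum_ite_eq]
    by_cases hq : ((v⁻¹ : SL(2, ℤ)) : Gamma0Coset N) = q
    · rw [if_pos hq, if_pos]
      simp only [R, Finset.mem_filter, List.mem_toFinset, List.mem_map]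
      exact ⟨⟨v, hv, rfl⟩, by rw [canon_inv]; exact hq⟩
    · rw [if_neg hq, if_neg]
      simp only [R, Finset.mem_filter, List.mem_toFinset, List.mem_map, not_and]
      intro _
      rw [canon_inv]; exact hq
  have hW1 : ∀ h ∈ W, h ∈ W ++ W.map (fun h ↦ h * S) := fun h hh ↦ List.mem_append_left _ hh
  have hW2 : ∀ h ∈ W, h * S ∈ W ++ W.map (fun h ↦ h * S) := fun h hh ↦
    List.mem_append_right _ (List.mem_map.mpr ⟨h, hh, rfl⟩)
  -- rewrite both indicators, swap the sums, and apply the tree property edge by edge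
  have e1 : (W.map fun h ↦ (if ((h⁻¹ : SL(2, ℤ)) : Gamma0Coset N) = q then (1 : ℤ) else 0) -
      (if (((h * S)⁻¹ : SL(2, ℤ)) : Gamma0Coset N) = q then (1 : ℤ) else 0)) =
      W.map fun h ↦ ∑ r ∈ R, ((if canon h = r then (1 : ℤ) else 0) - (if canon (h * S) = r then (1 : ℤ) else 0)) := by
    refine List.map_congr_left fun h hh ↦ ?_
    rw [hind h (hW1 h hh), hind (h * S) (hW2 h hh), Finset.sum_sub_distrib]
  rw [e1, list_sum_map_finset_sum]
  refine Finset.sum_eq_zero fun r hr ↦ ?_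
  -- `r` is canonical: `canon r = r`
  have hrc : canon r = r := by
    simp only [R, Finset.mem_filter, List.mem_toFinset, List.mem_map] at hr
    obtain ⟨⟨v, _, hv⟩, _⟩ := hr
    rw [← hv]; exact canon_idem v
  have e2 : (W.map fun h ↦ ((if canon h = r then (1 : ℤ) else 0) - (if canon (h * S) = r then (1 : ℤ) else 0))) =
      W.map fun h ↦ (if (h = r ∨ h = -r) then (1 : ℤ) else 0) - (if (h * S = r ∨ h * S = -r) then (1 : ℤ) else 0) := by
    refine List.map_congr_left fun h _ ↦ ?_
    rw [if_congr (canon_iff h r hrc) rfl rfl, if_congr (canon_iff (h * S) r hrc) rfl rfl]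
  rw [e2]
  exact dualChain_closed_netCrossing_eq_zero W hW r

end Closed

/-! ## §2. Independence of the chain, invariance under `Γ₀(N)`, additivity -/

section Additive

variable {N : ℕ}

/-- Reversing a list of steps negates the crossing vector: `vec(D·S) = −vec(D)` (`(hSS)⁻¹Γ₀(N) = h⁻¹Γ₀(N)`). [folklore] -/
theorem dualChainVec_map_mul_S (D : List SL(2, ℤ)) (q : Gamma0Coset N) :
    ((D.map fun h ↦ h * S).map fun h ↦ (Pi.single ((h⁻¹ : SL(2, ℤ)) : Gamma0Coset N) (1 : ℤ) -
      Pi.single (((h * S)⁻¹ : SL(2, ℤ)) : Gamma0Coset N) 1 : Gamma0Coset N → ℤ)).sum q =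
    -(D.map fun h ↦ (Pi.single ((h⁻¹ : SL(2, ℤ)) : Gamma0Coset N) (1 : ℤ) -
      Pi.single (((h * S)⁻¹ : SL(2, ℤ)) : Gamma0Coset N) 1 : Gamma0Coset N → ℤ)).sum q := by
  rw [dualChainVec_apply, dualChainVec_apply, List.sum_neg, List.map_map, List.map_map]
  congr 1
  refine List.map_congr_left fun h _ ↦ ?_
  have e : ((((h * S * S)⁻¹ : SL(2, ℤ))) : Gamma0Coset N) = ((h⁻¹ : SL(2, ℤ)) : Gamma0Coset N) := by
    rw [mul_assoc, S_mul_S_eq_neg_one, mul_neg_one, QuotientGroup.eq, inv_inv, neg_mul, mul_inv_cancel]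
    simp [Gamma0_mem]
  simp only [Function.comp_apply, e, neg_sub]

/-- **Two dual chains of the same `k` have the same crossing vector** (their difference is a closed dual chain). [cite: Manin1972, §1.5] -/
theorem dualChainVec_eq_of_dualChain (k : SL(2, ℤ)) (D D' : List SL(2, ℤ))
    (hD : ∀ {A : Type} [AddCommGroup A] (G : SL(2, ℤ) → A),
      (∀ x, G (x * (S * T⁻¹)) = G x) → (∀ x, G (-x) = G x) → (D.map fun h ↦ G h - G (h * S)).sum = G k - G 1)
    (hD' : ∀ {A : Type} [AddCommGroup A] (G : SL(2, ℤ) → A),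
      (∀ x, G (x * (S * T⁻¹)) = G x) → (∀ x, G (-x) = G x) → (D'.map fun h ↦ G h - G (h * S)).sum = G k - G 1)
    (q : Gamma0Coset N) :
    (D.map fun h ↦ (Pi.single ((h⁻¹ : SL(2, ℤ)) : Gamma0Coset N) (1 : ℤ) -
      Pi.single (((h * S)⁻¹ : SL(2, ℤ)) : Gamma0Coset N) 1 : Gamma0Coset N → ℤ)).sum q =
    (D'.map fun h ↦ (Pi.single ((h⁻¹ : SL(2, ℤ)) : Gamma0Coset N) (1 : ℤ) -
      Pi.single (((h * S)⁻¹ : SL(2, ℤ)) : Gamma0Coset N) 1 : Gamma0Coset N → ℤ)).sum q := by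
  have hcl : ∀ {A : Type} [AddCommGroup A] (G : SL(2, ℤ) → A), (∀ x, G (x * (S * T⁻¹)) = G x) → (∀ x, G (-x) = G x) →
      ((D ++ D'.map fun h ↦ h * S).map fun h ↦ G h - G (h * S)).sum = 0 := by
    intro A _ G hτ hn
    rw [List.map_append, List.sum_append, hD G hτ hn, List.map_map]
    have e : (D'.map ((fun h ↦ G h - G (h * S)) ∘ fun h ↦ h * S)).sum = -(D'.map fun h ↦ G h - G (h * S)).sum := by
      rw [List.sum_neg, List.map_map]
      congr 1
      refine List.map_congr_left fun h _ ↦ ?_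
      simp only [Function.comp_apply, mul_assoc, S_mul_S_eq_neg_one, mul_neg_one, hn, neg_sub]
    rw [e, hD' G hτ hn]
    abel
  have h0 := dualChainVec_eq_zero_of_closed (N := N) _ hcl q
  rw [List.map_append, List.sum_append, Pi.add_apply, dualChainVec_map_mul_S] at h0
  omega

/-- **`Γ₀(N)`-invariance**: shifting a list by `γ ∈ Γ₀(N)` on the left does not change its crossing vector. [folklore] -/
theorem dualChainVec_map_mul_left (γ : Gamma0 N) (D : List SL(2, ℤ)) (q : Gamma0Coset N) :
    ((D.map fun h ↦ (γ : SL(2, ℤ)) * h).map fun h ↦ (Pi.single ((h⁻¹ : SL(2, ℤ)) : Gamma0Coset N) (1 : ℤ) -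
      Pi.single (((h * S)⁻¹ : SL(2, ℤ)) : Gamma0Coset N) 1 : Gamma0Coset N → ℤ)).sum q =
    (D.map fun h ↦ (Pi.single ((h⁻¹ : SL(2, ℤ)) : Gamma0Coset N) (1 : ℤ) -
      Pi.single (((h * S)⁻¹ : SL(2, ℤ)) : Gamma0Coset N) 1 : Gamma0Coset N → ℤ)).sum q := by
  have e : ∀ g : SL(2, ℤ), (((((γ : SL(2, ℤ)) * g)⁻¹ : SL(2, ℤ))) : Gamma0Coset N) = ((g⁻¹ : SL(2, ℤ)) : Gamma0Coset N) :=
    fun g ↦ by rw [mul_inv_rev, QuotientGroup.eq]; simp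
  have el : ((D.map fun h ↦ (γ : SL(2, ℤ)) * h).map fun h ↦ (Pi.single ((h⁻¹ : SL(2, ℤ)) : Gamma0Coset N) (1 : ℤ) -
      Pi.single (((h * S)⁻¹ : SL(2, ℤ)) : Gamma0Coset N) 1 : Gamma0Coset N → ℤ)) =
      D.map fun h ↦ (Pi.single ((h⁻¹ : SL(2, ℤ)) : Gamma0Coset N) (1 : ℤ) -
        Pi.single (((h * S)⁻¹ : SL(2, ℤ)) : Gamma0Coset N) 1 : Gamma0Coset N → ℤ) := by
    rw [List.map_map]
    refine List.map_congr_left fun h _ ↦ ?_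
    simp only [Function.comp_apply, mul_assoc, e]
  rw [el]

/-- **Additivity.** If `D₁, D₂` are dual chains of `γ₁, γ₂ ∈ Γ₀(N)` and `D` is a dual chain of `γ₁γ₂`, then `vec D = vec D₁ + vec D₂`
(`D₁ ++ γ₁·D₂` is a dual chain of `γ₁γ₂`; chain independence; `Γ₀(N)`-invariance). [cite: Manin1972, §1.5] -/
theorem dualChainVec_mul (γ₁ γ₂ : Gamma0 N) (D₁ D₂ D : List SL(2, ℤ))
    (hD₁ : ∀ {A : Type} [AddCommGroup A] (G : SL(2, ℤ) → A),
      (∀ x, G (x * (S * T⁻¹)) = G x) → (∀ x, G (-x) = G x) → (D₁.map fun h ↦ G h - G (h * S)).sum = G (γ₁ : SL(2, ℤ)) - G 1)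
    (hD₂ : ∀ {A : Type} [AddCommGroup A] (G : SL(2, ℤ) → A),
      (∀ x, G (x * (S * T⁻¹)) = G x) → (∀ x, G (-x) = G x) → (D₂.map fun h ↦ G h - G (h * S)).sum = G (γ₂ : SL(2, ℤ)) - G 1)
    (hD : ∀ {A : Type} [AddCommGroup A] (G : SL(2, ℤ) → A),
      (∀ x, G (x * (S * T⁻¹)) = G x) → (∀ x, G (-x) = G x) →
        (D.map fun h ↦ G h - G (h * S)).sum = G ((γ₁ * γ₂ : Gamma0 N) : SL(2, ℤ)) - G 1)
    (q : Gamma0Coset N) :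
    (D.map fun h ↦ (Pi.single ((h⁻¹ : SL(2, ℤ)) : Gamma0Coset N) (1 : ℤ) -
      Pi.single (((h * S)⁻¹ : SL(2, ℤ)) : Gamma0Coset N) 1 : Gamma0Coset N → ℤ)).sum q =
    (D₁.map fun h ↦ (Pi.single ((h⁻¹ : SL(2, ℤ)) : Gamma0Coset N) (1 : ℤ) -
      Pi.single (((h * S)⁻¹ : SL(2, ℤ)) : Gamma0Coset N) 1 : Gamma0Coset N → ℤ)).sum q +
    (D₂.map fun h ↦ (Pi.single ((h⁻¹ : SL(2, ℤ)) : Gamma0Coset N) (1 : ℤ) -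
      Pi.single (((h * S)⁻¹ : SL(2, ℤ)) : Gamma0Coset N) 1 : Gamma0Coset N → ℤ)).sum q := by
  have hD' : ∀ {A : Type} [AddCommGroup A] (G : SL(2, ℤ) → A), (∀ x, G (x * (S * T⁻¹)) = G x) → (∀ x, G (-x) = G x) →
      ((D₁ ++ D₂.map fun h ↦ (γ₁ : SL(2, ℤ)) * h).map fun h ↦ G h - G (h * S)).sum = G ((γ₁ * γ₂ : Gamma0 N) : SL(2, ℤ)) - G 1 := by
    intro A _ G hτ hn
    rw [List.map_append, List.sum_append, hD₁ G hτ hn, List.map_map]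
    have h2 := hD₂ (fun g ↦ G ((γ₁ : SL(2, ℤ)) * g)) (fun g ↦ by rw [← mul_assoc, hτ]) (fun g ↦ by simp only [mul_neg, hn])
    simp only [mul_one] at h2
    rw [show (D₂.map ((fun h ↦ G h - G (h * S)) ∘ fun h ↦ (γ₁ : SL(2, ℤ)) * h)).sum =
      (D₂.map fun g ↦ G ((γ₁ : SL(2, ℤ)) * g) - G ((γ₁ : SL(2, ℤ)) * (g * S))).sum from by
        congr 1; exact List.map_congr_left fun g _ ↦ by simp [mul_assoc], h2, Subgroup.coe_mul]
    abel
  rw [dualChainVec_eq_of_dualChain _ D _ hD hD' q, List.map_append, List.sum_append, Pi.add_apply, dualChainVec_map_mul_left]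

end Additive

/-! ## §3. Elliptic elements have zero crossing vector -/

section Elliptic

variable {N : ℕ}

/-- **Order-`4` elliptic elements**: if `γk = kS` (`γ = kSk⁻¹ ∈ Γ₀(N)`), every dual chain of `γ` has crossing vector `0` — the walk to the
triangle of `k`, the single FOLDED edge `{k∞, k0}` (whose coset is `S`-fixed, so its signed contribution `e_{(kS)⁻¹Γ₀} − e_{k⁻¹Γ₀}` vanishes),
and the walk back. [cite: Manin1972, §1.5] -/
theorem dualChainVec_eq_zero_of_conj_S (γ : Gamma0 N) (k : SL(2, ℤ)) (hγ : (γ : SL(2, ℤ)) * k = k * S) (D : List SL(2, ℤ))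
    (hD : ∀ {A : Type} [AddCommGroup A] (G : SL(2, ℤ) → A),
      (∀ x, G (x * (S * T⁻¹)) = G x) → (∀ x, G (-x) = G x) → (D.map fun h ↦ G h - G (h * S)).sum = G (γ : SL(2, ℤ)) - G 1)
    (q : Gamma0Coset N) :
    (D.map fun h ↦ (Pi.single ((h⁻¹ : SL(2, ℤ)) : Gamma0Coset N) (1 : ℤ) -
      Pi.single (((h * S)⁻¹ : SL(2, ℤ)) : Gamma0Coset N) 1 : Gamma0Coset N → ℤ)).sum q = 0 := by
  obtain ⟨Dk, hDk⟩ := exists_dualChain k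
  -- the explicit dual chain `Dk ++ [kS] ++ γ·(Dk·S)` of `γ = k S k⁻¹`
  have hγ' : (γ : SL(2, ℤ)) = k * S * k⁻¹ := by rw [← hγ, mul_inv_cancel_right]
  have hE : ∀ {A : Type} [AddCommGroup A] (G : SL(2, ℤ) → A), (∀ x, G (x * (S * T⁻¹)) = G x) → (∀ x, G (-x) = G x) →
      ((Dk ++ [k * S] ++ (Dk.map fun h ↦ h * S).map fun h ↦ (γ : SL(2, ℤ)) * h).map fun h ↦ G h - G (h * S)).sum =
        G (γ : SL(2, ℤ)) - G 1 := by
    intro A _ G hτ hn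
    rw [List.map_append, List.map_append, List.sum_append, List.sum_append, hDk G hτ hn, List.map_singleton,
      List.sum_singleton, mul_assoc k S S, S_mul_S_eq_neg_one, mul_neg_one, hn, List.map_map, List.map_map]
    have h2 := hDk (fun g ↦ G ((γ : SL(2, ℤ)) * g)) (fun g ↦ by rw [← mul_assoc, hτ]) (fun g ↦ by simp only [mul_neg, hn])
    have e : (Dk.map (((fun h ↦ G h - G (h * S)) ∘ fun h ↦ (γ : SL(2, ℤ)) * h) ∘ fun h ↦ h * S)).sum =
        -(Dk.map fun g ↦ G ((γ : SL(2, ℤ)) * g) - G ((γ : SL(2, ℤ)) * (g * S))).sum := by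
      rw [List.sum_neg, List.map_map]
      congr 1
      refine List.map_congr_left fun g _ ↦ ?_
      have e3 : (γ : SL(2, ℤ)) * (g * S) * S = -((γ : SL(2, ℤ)) * g) := by
        rw [mul_assoc, mul_assoc g, S_mul_S_eq_neg_one, mul_neg_one, mul_neg]
      simp only [Function.comp_apply]
      rw [e3, hn, neg_sub]
    rw [e, h2, mul_one, hγ', inv_mul_cancel_right]
    abel
  rw [dualChainVec_eq_of_dualChain _ D _ hD hE q, List.map_append, List.map_append, List.sum_append, List.sum_append,
    Pi.add_apply, Pi.add_apply, dualChainVec_map_mul_left, dualChainVec_map_mul_S, List.map_singleton, List.sum_singleton]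
  -- the folded edge: `(kSS)⁻¹Γ₀ = k⁻¹Γ₀ = (kS)⁻¹Γ₀` (the coset `k⁻¹Γ₀(N)` is `S`-fixed since `kSk⁻¹ = γ ∈ Γ₀(N)`)
  have e1 : ((((k * S * S)⁻¹ : SL(2, ℤ))) : Gamma0Coset N) = ((k⁻¹ : SL(2, ℤ)) : Gamma0Coset N) := by
    rw [mul_assoc, S_mul_S_eq_neg_one, mul_neg_one, QuotientGroup.eq, inv_inv, neg_mul, mul_inv_cancel]
    simp [Gamma0_mem]
  have e2 : ((((k * S)⁻¹ : SL(2, ℤ))) : Gamma0Coset N) = ((k⁻¹ : SL(2, ℤ)) : Gamma0Coset N) := by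
    rw [QuotientGroup.eq, inv_inv, ← hγ']
    exact γ.2
  rw [e1, e2, sub_self, Pi.zero_apply, add_zero, add_neg_cancel]

/-- **Order-`3` (and `6`) elliptic elements**: if `γk = kτ` (`τ = ST⁻¹`, `γ = kτk⁻¹`), every dual chain of `γ` has crossing vector `0`
(`τ` fixes the base triangle: the walk to the triangle of `k` and straight back). [cite: Manin1972, §1.5] -/
theorem dualChainVec_eq_zero_of_conj_tau (γ : Gamma0 N) (k : SL(2, ℤ)) (hγ : (γ : SL(2, ℤ)) * k = k * (S * T⁻¹)) (D : List SL(2, ℤ))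
    (hD : ∀ {A : Type} [AddCommGroup A] (G : SL(2, ℤ) → A),
      (∀ x, G (x * (S * T⁻¹)) = G x) → (∀ x, G (-x) = G x) → (D.map fun h ↦ G h - G (h * S)).sum = G (γ : SL(2, ℤ)) - G 1)
    (q : Gamma0Coset N) :
    (D.map fun h ↦ (Pi.single ((h⁻¹ : SL(2, ℤ)) : Gamma0Coset N) (1 : ℤ) -
      Pi.single (((h * S)⁻¹ : SL(2, ℤ)) : Gamma0Coset N) 1 : Gamma0Coset N → ℤ)).sum q = 0 := by
  obtain ⟨Dk, hDk⟩ := exists_dualChain k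
  have hγ' : (γ : SL(2, ℤ)) = k * (S * T⁻¹) * k⁻¹ := by rw [← hγ, mul_inv_cancel_right]
  have hE : ∀ {A : Type} [AddCommGroup A] (G : SL(2, ℤ) → A), (∀ x, G (x * (S * T⁻¹)) = G x) → (∀ x, G (-x) = G x) →
      ((Dk ++ (Dk.map fun h ↦ h * S).map fun h ↦ (γ : SL(2, ℤ)) * h).map fun h ↦ G h - G (h * S)).sum = G (γ : SL(2, ℤ)) - G 1 := by
    intro A _ G hτ hn
    rw [List.map_append, List.sum_append, hDk G hτ hn, List.map_map, List.map_map]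
    have h2 := hDk (fun g ↦ G ((γ : SL(2, ℤ)) * g)) (fun g ↦ by rw [← mul_assoc, hτ]) (fun g ↦ by simp only [mul_neg, hn])
    have e : (Dk.map (((fun h ↦ G h - G (h * S)) ∘ fun h ↦ (γ : SL(2, ℤ)) * h) ∘ fun h ↦ h * S)).sum =
        -(Dk.map fun g ↦ G ((γ : SL(2, ℤ)) * g) - G ((γ : SL(2, ℤ)) * (g * S))).sum := by
      rw [List.sum_neg, List.map_map]
      congr 1
      refine List.map_congr_left fun g _ ↦ ?_
      have e3 : (γ : SL(2, ℤ)) * (g * S) * S = -((γ : SL(2, ℤ)) * g) := by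
        rw [mul_assoc, mul_assoc g, S_mul_S_eq_neg_one, mul_neg_one, mul_neg]
      simp only [Function.comp_apply]
      rw [e3, hn, neg_sub]
    rw [e, h2, mul_one, hγ', inv_mul_cancel_right, hτ]
    abel
  rw [dualChainVec_eq_of_dualChain _ D _ hD hE q, List.map_append, List.sum_append, Pi.add_apply, dualChainVec_map_mul_left,
    dualChainVec_map_mul_S, add_neg_cancel]

end Elliptic

end Summit.BirchSwinnertonDyer.BirchSwinnertonDyer.Theorems.ThetaLayerLambdaCongruenceAtTwo

end
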